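import Summits.QuantumFields.YangMills.Theorems.BalabanUVNodesN21GappedTopCut13CoPHDefs

/-!
# N21 (NE7c) · THE GAPPED TOP CUT FOR BOTH INDICATOR FAMILIES OF THE LAST 𝐓-STEP — definition lane, part 1 (the (3.3) side): the ONE (3.3) factor of a
# cube at a letter, the GAPPED (3.3) label weight (small-approximate-fluctuation factors at `δlo`, NEW large-fluctuation factors at `δhi`, the gap `(δlo, δhi)`
# OPEN) and the (3.3) collar count functional; part 2 (`…N21GappedTopPair13CoPHSlotDefs`): the pair-lettered term, the doubly-gapped label ∕ step weights, the
# doubly-gapped top slot ∕ core and the two-collar shell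

WIDTH SEAT `pub-ymgap-dag-n21-w7` (g2), node N21 = NE7c (NOT PRINTED; NOT proved at print's fixed thresholds); lane K3⁷ `SpineGivenEndpointR13SepCoPH`
(stmt-QuantumFields-20544, `--supports … --as helper`; COUNT-NEUTRAL).  DEFINITION LANE: `def`s + faces; NO estimate.  The OBJECT half of the (3.3) family,
accepted from the lane owner dag-n21-d g11 (OFFER-2, cell bus 2026-08-28 10:02Z: «the (3.3) family's object half … is YOURS; new paths»), typed on the lane
owner's conventions: imports U1 `…N21GappedTopCut13CoPHDefs` (p617809: `aGapAt`, `ωGapAt`, `wGapAt`, `topGapSlotAt∕CoreAt∕ShellAt`, `collarAt`; through it T1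
`…N21SelectedTopCut13CoPHDefs`: `topLetter`, `wTopAt`, `topSlotAt`, `topClassWeightAt`; def-T FILE 19 `Node00/StepWeightsAtThresholds`: `bWeightAt`, `ωOfRecordAt`,
`wOfRecordAt`, `twoDeltaLetterOfRecord`, `tstepOfRecordAt`; [III] `B14.Sect3Decomp`: `SmallApproxFluct`, `chiPrime`, `chiPrimec`).  [III] = [Balaban1988Convergent].

WHY (ROAD-S §2 of `pub-ymgap-dag-n21-d/ROAD-S.md` and U1's header: «ONLY the (2.17)∕(3.2) factor family of the TOP step is re-lettered (the (3.3) `b|_{2δ_k}` family …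
LOCATED, not typed)»).  Under `T4IndicatorShell`'s design (i) (identical core indicators `χ^Aχ^B` in both runs, mixed pieces to the bad class, single-run shells on
BOTH sides of each cut) EVERY background-mediated indicator family of the top 𝐓-step needs a two-sided collar.  The top step carries, besides the (3.2) family
`a|_θ(P)` (U1), the (3.3) family `b|_{δ′}(P, Q) = χ′_k(qcubes ∖ Q)|_{δ′} · χ′ᶜ_k(Q)|_{δ′}` ([III] (3.3)–(3.4) p. 265): its factors test `|V_k(b)(V^{(k)}_{□′}(b))⁻¹ − 1| < δ′`
against the cube-local minimiser `V^{(k)}_{□′}` (`Vbox`) — background-mediated, hence run-dependent — on the SAME cube index `Iχ` as the (3.2) family; they are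
`{0,1}`-valued and letter-MONOTONE, and `Σ_Q b|_{δ′}(P, Q) = 1` at EVERY letter (`sum_bWeightAt` = r11's `eq33`).  THIS FILE types the objects with which the lane
owner's gapped road (cover ∕ graph ∕ count ∕ selected letter) runs for BOTH families at once: at the MAJORANT level the two families separate (unity of the step
weights at letters kills the other family's letter), so the (3.2) depth `i⋆` and the (3.3) depth `j⋆` are selected INDEPENDENTLY and the doubly-gapped shell at
`(i⋆, j⋆)` is `≤ 4(2L^m)⁴·(1∕(n₁+1) + 1∕(n₂+1))·Σ_s classWeight_k` per run ((M1)-FREE; the sequel files prove it; the product-box alternative selecting on true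
masses is `…N21JointLetterSelection`, p623373).

WHAT IS DEFINED (NODE 00's generality `ν M p g k` ∕ `ϑ D g₀ os p g k`; the top is level `k + 1`, meant at `k + 1 = p.K`).
* §B1 `bFactorAt … δ′ s c U V′ := 1[SmallApproxFluct (sect3DataOfRecord … s) (avOfRecord …) δ′ U V′ c]` — the ONE (3.3) factor of the χ_{k+1}-cube `c` at letter
  `δ′` (reads the OLD history `s` through `sect3DataOfRecord`); `{0,1}`-valued, monotone in `δ′`, jointly measurable under (H-U); `bWeightAt_eq_prod` (def-T's
  `b|_{δ′}` as the product of the factors on the (3.3)-range).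
* §B2 ★ `bGapAt … δlo δhi s P Q U V′ := [Q ⊆ qcubes s P] · χ′(qcubes s P ∖ Q)|_{δlo} · χ′ᶜ(Q)|_{δhi}` — def-T's `bWeightAt δ′` with the two product halves read at two
  letters (`bGapAt δ δ = bWeightAt δ`, `rfl`); `0 ≤ bGap ≤ b|_{δ′}` for `δlo ≤ δ′ ≤ δhi`; jointly measurable.
* §B6 `collarBAt … δlo δhi s (U, V′) := Σ_{c : Iχ} (bFactor^{δhi}_c − bFactor^{δlo}_c)` — the number of χ_{k+1}-cubes whose (3.3) statistic lies in the collar `[δlo, δhi)`;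
  `0 ≤ collarB ≤ #Iχ` (`δlo ≤ δhi`), `|collarB| ≤ #Iχ`, jointly measurable under (H-U).
* §B7 `bCutGrid ν A₁ g k ρ′ j := 2δ_k·(1 − ρ′)^j` — the geometric grid of (3.3) letters (companion of the lane owner's `cutGrid`); `_zero`, `_zero_eq_letter`, `_succ`,
  `_succ_le_of_nonneg`.
* Part 2 (`…SlotDefs`, §B3–§B5): the pair-lettered term `wTop2At ∕ topSlot2At ∕ topClassWeight2At`, the doubly-gapped weights `ωGap2At ∕ wGap2At`, and
  `topGap2SlotAt ∕ topGap2CoreAt ∕ topGap2ShellAt`.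

HONEST FRAMING (binding).  Definitions + [folklore] bookkeeping over NODE 00's objects of record; NO estimate of Bałaban's asserted or used; the residual `ζ` ∕ (3.5),
the ℝ-side, the selector and everything below the top step are print's ∕ the record's (their two-run shells stay LOCATED); the top 𝐑-step is omitted as in T1 ∕ U1; the
common-refinement inequality «design-(i) shells ≤ gapped shells» (closeness + two-run site identification) and the core sandwich are the CONSUMER's; no lettered
spine READING is typed here; no `Provisos₁₃CoPH` inhabitant claimed (K0⁷ open); NE7c NOT PRINTED ∕ NOT proved at print's fixed thresholds; N21 NOT discharged; K3⁷
NOT claimed; counts UNMOVED (typed 28∕28 · discharged 5∕27, A 5∕28); never a count claim.  No `sorry`, no `axiom`, no `instance`, no `notation`.  One finite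
four-torus programme at fixed `ε` — NOT ℝ⁴, NOT OS, NOT a mass gap, NOT the Clay problem.
-/

noncomputable section

open scoped BigOperators
open Finset MeasureTheory

namespace Summit.QuantumFields.YangMills.Theorems.N21GappedTopPair13CoPH

open Literature.MathematicalPhysics.QuantumFieldTheory.Balaban1983to89
open Literature.MathematicalPhysics.QuantumFieldTheory.Balaban1983to89.T4Continuum
open Literature.MathematicalPhysics.QuantumFieldTheory.Balaban1983to89.Node00
open Summit.QuantumFields.YangMills.BalabanUVNodes.N19MGFRoadLiveSelectorTower (dressedSlotsOfDatum₉_nonneg)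
open Summit.QuantumFields.YangMills.BalabanUVNodes.N19MGFFormAtRecord (wOfRecord₉_nonneg)
open Summit.QuantumFields.YangMills.Theorems.N21ShellSplitOfRecord13CoPH
open B14.Sect3Decomp (SmallApproxFluct chiPrime chiPrimec)

/-! ## §B1 The ONE (3.3) factor of a cube AT A LETTER -/

section BFactor

variable (F : T4Family) (N : ℕ) [NeZero N] (ν : Stage7Numerics) (M : ℕ) (p : B12.RunParams) (g : ℕ → ℝ) (k : ℕ)

/-- **THE (3.3) TEST IS MONOTONE IN ITS LETTER**: `δ ≤ δ′` and `sup_b |V_k(b)(V^{(k)}_{□′}(b))⁻¹ − 1| < δ` give the same at `δ′`. [cite: Balaban1988Convergent, (3.3) p.265 (bookkeeping)] -/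
theorem smallApproxFluct_mono {δ δ' : ℝ} (h : δ ≤ δ') (s : SeqOfRecord F ν M g p.K k) (c : Iχ F ν p g k) (U : GaugeField (F.P p.K) k (SU N))
    (V' : GaugeField (F.P p.K) (k + 1) (SU N)) (hc : SmallApproxFluct (sect3DataOfRecord F N ν M p g k s) (avOfRecord F N p.K) δ U V' c) :
    SmallApproxFluct (sect3DataOfRecord F N ν M p g k s) (avOfRecord F N p.K) δ' U V' c :=
  fun b hb => lt_of_lt_of_le (hc b hb) h

open Classical in
/-- **THE ONE (3.3) FACTOR of the χ_{k+1}-cube `c` AT LETTER `δ′`**: `χ({sup_{b∈(□′^{∼2})^{(k)*}}|V_k(b)(V^{(k)}_{□′}(b))⁻¹ − 1| < δ′})(V_k, V_{k+1})` on the pinned (3.3) data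
of the old history `s` (`sect3DataOfRecord … s`, averaging of record) — one factor of r11's `chiPrime` at the letter `δ′` in place of `2δ_k`.
[cite: Balaban1988Convergent, (3.3)–(3.4) p.265] -/
def bFactorAt (δ' : ℝ) (s : SeqOfRecord F ν M g p.K k) (c : Iχ F ν p g k) (U : GaugeField (F.P p.K) k (SU N)) (V' : GaugeField (F.P p.K) (k + 1) (SU N)) : ℝ :=
  if SmallApproxFluct (sect3DataOfRecord F N ν M p g k s) (avOfRecord F N p.K) δ' U V' c then 1 else 0

/-- The (3.3) factor is idempotent (`{0,1}`-valued). [bookkeeping] -/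
theorem bFactorAt_mul_self (δ' : ℝ) (s : SeqOfRecord F ν M g p.K k) (c : Iχ F ν p g k) (U : GaugeField (F.P p.K) k (SU N))
    (V' : GaugeField (F.P p.K) (k + 1) (SU N)) :
    bFactorAt F N ν M p g k δ' s c U V' * bFactorAt F N ν M p g k δ' s c U V' = bFactorAt F N ν M p g k δ' s c U V' := by
  unfold bFactorAt; split_ifs <;> norm_num

/-- `0 ≤` the (3.3) factor. [bookkeeping] -/
theorem bFactorAt_nonneg (δ' : ℝ) (s : SeqOfRecord F ν M g p.K k) (c : Iχ F ν p g k) (U : GaugeField (F.P p.K) k (SU N))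
    (V' : GaugeField (F.P p.K) (k + 1) (SU N)) : 0 ≤ bFactorAt F N ν M p g k δ' s c U V' := by
  unfold bFactorAt; split_ifs <;> norm_num

/-- The (3.3) factor is `≤ 1`. [bookkeeping] -/
theorem bFactorAt_le_one (δ' : ℝ) (s : SeqOfRecord F ν M g p.K k) (c : Iχ F ν p g k) (U : GaugeField (F.P p.K) k (SU N))
    (V' : GaugeField (F.P p.K) (k + 1) (SU N)) : bFactorAt F N ν M p g k δ' s c U V' ≤ 1 := by
  unfold bFactorAt; split_ifs <;> norm_num

/-- **THE (3.3) FACTOR IS MONOTONE IN THE LETTER.** [bookkeeping] -/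
theorem bFactorAt_mono {δ δ' : ℝ} (h : δ ≤ δ') (s : SeqOfRecord F ν M g p.K k) (c : Iχ F ν p g k) (U : GaugeField (F.P p.K) k (SU N))
    (V' : GaugeField (F.P p.K) (k + 1) (SU N)) : bFactorAt F N ν M p g k δ s c U V' ≤ bFactorAt F N ν M p g k δ' s c U V' := by
  unfold bFactorAt
  by_cases h1 : SmallApproxFluct (sect3DataOfRecord F N ν M p g k s) (avOfRecord F N p.K) δ U V' c
  · rw [if_pos h1, if_pos (smallApproxFluct_mono F N ν M p g k h s c U V' h1)]
  · rw [if_neg h1]; split_ifs <;> norm_num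

/-- The (3.3) factor is jointly measurable in `(V′, U)` under (H-U) (def-T `measurableSet_smallApproxFluct_of_localBg`, K0c's absolute `localBgMeasurable`). [bookkeeping] -/
theorem measurable_bFactorAt (δ' : ℝ) (s : SeqOfRecord F ν M g p.K k) (c : Iχ F ν p g k) :
    Measurable (fun z : GaugeField (F.P p.K) (k + 1) (SU N) × GaugeField (F.P p.K) k (SU N) => bFactorAt F N ν M p g k δ' s c z.2 z.1) := by
  unfold bFactorAt
  exact Measurable.ite (measurableSet_smallApproxFluct_of_localBg (localBgMeasurable F N ν) M p g k s δ' c) measurable_const measurable_const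

/-- **def-T's (3.3) WEIGHT AS A PRODUCT OF THE FACTORS** on the (3.3)-range: `b|_{δ′}(P, Q) = Π_{qcubes ∖ Q} bFactor^{δ′} · Π_Q (1 − bFactor^{δ′})`. [bookkeeping] -/
theorem bWeightAt_eq_prod (δ' : ℝ) (s : SeqOfRecord F ν M g p.K k) {Pl Ql : Finset (Iχ F ν p g k)} (hQ : Ql ⊆ qcubes F ν M p g k s Pl)
    (U : GaugeField (F.P p.K) k (SU N)) (V' : GaugeField (F.P p.K) (k + 1) (SU N)) :
    bWeightAt F N ν M p g k δ' s Pl Ql U V' =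
      (∏ c ∈ qcubes F ν M p g k s Pl \ Ql, bFactorAt F N ν M p g k δ' s c U V') * ∏ c ∈ Ql, (1 - bFactorAt F N ν M p g k δ' s c U V') := by
  classical
  rw [bWeightAt, if_pos hQ]
  unfold chiPrime chiPrimec bFactorAt
  congr 1
  exact Finset.prod_congr rfl fun c _ => by
    by_cases h : SmallApproxFluct (sect3DataOfRecord F N ν M p g k s) (avOfRecord F N p.K) δ' U V' c
    · rw [if_pos h, if_pos h]; norm_num
    · rw [if_neg h, if_neg h]; norm_num

end BFactor

/-! ## §B2 The gapped (3.3) label weight -/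

section BGap

variable (F : T4Family) (N : ℕ) [NeZero N] (ν : Stage7Numerics) (M : ℕ) (p : B12.RunParams) (g : ℕ → ℝ) (k : ℕ)

/-- ★ **THE GAPPED (3.3) LABEL WEIGHT** of `Q_{k+1}` given `P_{k+1}`, with small-approximate-fluctuation letter `δlo` and large-fluctuation letter `δhi`:
`[Q ⊆ qcubes s P] · χ′(qcubes s P ∖ Q)|_{δlo} · χ′ᶜ(Q)|_{δhi}` — def-T's `bWeightAt … δ′` is the instance `δlo = δhi = δ′`. [cite: Balaban1988Convergent, (3.3)–(3.4) p.265 (bookkeeping)] -/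
def bGapAt (δlo δhi : ℝ) (s : SeqOfRecord F ν M g p.K k) (Pl Ql : Finset (Iχ F ν p g k)) (U : GaugeField (F.P p.K) k (SU N))
    (V' : GaugeField (F.P p.K) (k + 1) (SU N)) : ℝ :=
  if Ql ⊆ qcubes F ν M p g k s Pl then
    chiPrime (sect3DataOfRecord F N ν M p g k s) (avOfRecord F N p.K) δlo (qcubes F ν M p g k s Pl \ Ql : Finset (Iχ F ν p g k)) U V' *
      chiPrimec (sect3DataOfRecord F N ν M p g k s) (avOfRecord F N p.K) δhi Ql U V'
  else 0

/-- Face: at equal letters the gapped (3.3) weight IS def-T's `bWeightAt` (definitional). [bookkeeping] -/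
theorem bGapAt_self (δ : ℝ) : bGapAt F N ν M p g k δ δ = bWeightAt F N ν M p g k δ := rfl

/-- Unfolding on the (3.3) range into the per-cube factors at the two letters. [bookkeeping] -/
theorem bGapAt_of_subset (δlo δhi : ℝ) (s : SeqOfRecord F ν M g p.K k) {Pl Ql : Finset (Iχ F ν p g k)} (hQ : Ql ⊆ qcubes F ν M p g k s Pl)
    (U : GaugeField (F.P p.K) k (SU N)) (V' : GaugeField (F.P p.K) (k + 1) (SU N)) :
    bGapAt F N ν M p g k δlo δhi s Pl Ql U V' =
      (∏ c ∈ qcubes F ν M p g k s Pl \ Ql, bFactorAt F N ν M p g k δlo s c U V') * ∏ c ∈ Ql, (1 - bFactorAt F N ν M p g k δhi s c U V') := by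
  classical
  rw [bGapAt, if_pos hQ]
  unfold chiPrime chiPrimec bFactorAt
  congr 1
  exact Finset.prod_congr rfl fun c _ => by
    by_cases h : SmallApproxFluct (sect3DataOfRecord F N ν M p g k s) (avOfRecord F N p.K) δhi U V' c
    · rw [if_pos h, if_pos h]; norm_num
    · rw [if_neg h, if_neg h]; norm_num

/-- Unfolding off the (3.3) range: `0`. [bookkeeping] -/
theorem bGapAt_of_not_subset (δlo δhi : ℝ) (s : SeqOfRecord F ν M g p.K k) {Pl Ql : Finset (Iχ F ν p g k)} (hQ : ¬ Ql ⊆ qcubes F ν M p g k s Pl)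
    (U : GaugeField (F.P p.K) k (SU N)) (V' : GaugeField (F.P p.K) (k + 1) (SU N)) : bGapAt F N ν M p g k δlo δhi s Pl Ql U V' = 0 := by
  rw [bGapAt, if_neg hQ]

/-- `0 ≤` the gapped (3.3) weight. [bookkeeping] -/
theorem bGapAt_nonneg (δlo δhi : ℝ) (s : SeqOfRecord F ν M g p.K k) (Pl Ql : Finset (Iχ F ν p g k)) (U : GaugeField (F.P p.K) k (SU N))
    (V' : GaugeField (F.P p.K) (k + 1) (SU N)) : 0 ≤ bGapAt F N ν M p g k δlo δhi s Pl Ql U V' := by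
  by_cases hQ : Ql ⊆ qcubes F ν M p g k s Pl
  · rw [bGapAt_of_subset F N ν M p g k δlo δhi s hQ]
    exact mul_nonneg (Finset.prod_nonneg fun c _ => bFactorAt_nonneg F N ν M p g k δlo s c U V')
      (Finset.prod_nonneg fun c _ => sub_nonneg.2 (bFactorAt_le_one F N ν M p g k δhi s c U V'))
  · rw [bGapAt_of_not_subset F N ν M p g k δlo δhi s hQ]

/-- ★ **THE GAPPED (3.3) WEIGHT IS BELOW THE ONE-LETTER WEIGHT AT EVERY LETTER IN THE GAP**: `δlo ≤ δ′ ≤ δhi ⇒ bGap(δlo, δhi) ≤ b|_{δ′}` (letter-monotone factors in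
`[0,1]`). [bookkeeping] -/
theorem bGapAt_le_bWeightAt {δlo δ' δhi : ℝ} (hlo : δlo ≤ δ') (hhi : δ' ≤ δhi) (s : SeqOfRecord F ν M g p.K k) (Pl Ql : Finset (Iχ F ν p g k))
    (U : GaugeField (F.P p.K) k (SU N)) (V' : GaugeField (F.P p.K) (k + 1) (SU N)) :
    bGapAt F N ν M p g k δlo δhi s Pl Ql U V' ≤ bWeightAt F N ν M p g k δ' s Pl Ql U V' := by
  by_cases hQ : Ql ⊆ qcubes F ν M p g k s Pl
  · rw [bGapAt_of_subset F N ν M p g k δlo δhi s hQ, bWeightAt_eq_prod F N ν M p g k δ' s hQ]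
    refine mul_le_mul ?_ ?_ (Finset.prod_nonneg fun c _ => sub_nonneg.2 (bFactorAt_le_one F N ν M p g k δhi s c U V'))
      (Finset.prod_nonneg fun c _ => bFactorAt_nonneg F N ν M p g k δ' s c U V')
    · exact Finset.prod_le_prod (fun c _ => bFactorAt_nonneg F N ν M p g k δlo s c U V') fun c _ => bFactorAt_mono F N ν M p g k hlo s c U V'
    · exact Finset.prod_le_prod (fun c _ => sub_nonneg.2 (bFactorAt_le_one F N ν M p g k δhi s c U V'))
        fun c _ => sub_le_sub_left (bFactorAt_mono F N ν M p g k hhi s c U V') 1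
  · rw [bGapAt_of_not_subset F N ν M p g k δlo δhi s hQ, bWeightAt, if_neg hQ]

/-- the gapped (3.3) weight is jointly measurable in `(V′, U)` under (H-U). [bookkeeping] -/
theorem measurable_bGapAt (δlo δhi : ℝ) (s : SeqOfRecord F ν M g p.K k) (Pl Ql : Finset (Iχ F ν p g k)) :
    Measurable (fun z : GaugeField (F.P p.K) (k + 1) (SU N) × GaugeField (F.P p.K) k (SU N) => bGapAt F N ν M p g k δlo δhi s Pl Ql z.2 z.1) := by
  by_cases hQ : Ql ⊆ qcubes F ν M p g k s Pl
  · have e : (fun z : GaugeField (F.P p.K) (k + 1) (SU N) × GaugeField (F.P p.K) k (SU N) => bGapAt F N ν M p g k δlo δhi s Pl Ql z.2 z.1) =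
        fun z => (∏ c ∈ qcubes F ν M p g k s Pl \ Ql, bFactorAt F N ν M p g k δlo s c z.2 z.1) *
          ∏ c ∈ Ql, (1 - bFactorAt F N ν M p g k δhi s c z.2 z.1) :=
      funext fun z => bGapAt_of_subset F N ν M p g k δlo δhi s hQ z.2 z.1
    rw [e]
    exact (Finset.measurable_prod _ fun c _ => measurable_bFactorAt F N ν M p g k δlo s c).mul
      (Finset.measurable_prod _ fun c _ => measurable_const.sub (measurable_bFactorAt F N ν M p g k δhi s c))
  · have e : (fun z : GaugeField (F.P p.K) (k + 1) (SU N) × GaugeField (F.P p.K) k (SU N) => bGapAt F N ν M p g k δlo δhi s Pl Ql z.2 z.1) = fun _ => 0 :=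
      funext fun z => bGapAt_of_not_subset F N ν M p g k δlo δhi s hQ z.2 z.1
    rw [e]
    exact measurable_const

end BGap

/-! ## §B6 The (3.3) collar count functional -/

section CollarB

variable (F : T4Family) (N : ℕ) [NeZero N] (ν : Stage7Numerics) (M : ℕ) (p : B12.RunParams) (g : ℕ → ℝ) (k : ℕ)

/-- **THE (3.3) COLLAR COUNT FUNCTIONAL** of the collar `[δlo, δhi)` at the old history `s`: `Σ_{c : Iχ} (bFactor^{δhi}_c(U,V′) − bFactor^{δlo}_c(U,V′))` over ALL χ_{k+1}-cubes —
for `δlo ≤ δhi` the number of cubes whose (3.3) statistic passes at `δhi` and fails at `δlo`. [bookkeeping] -/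
def collarBAt (δlo δhi : ℝ) (s : SeqOfRecord F ν M g p.K k) (U : GaugeField (F.P p.K) k (SU N)) (V' : GaugeField (F.P p.K) (k + 1) (SU N)) : ℝ :=
  ∑ c : Iχ F ν p g k, (bFactorAt F N ν M p g k δhi s c U V' - bFactorAt F N ν M p g k δlo s c U V')

/-- `0 ≤` the (3.3) collar count for `δlo ≤ δhi`. [bookkeeping] -/
theorem collarBAt_nonneg {δlo δhi : ℝ} (h : δlo ≤ δhi) (s : SeqOfRecord F ν M g p.K k) (U : GaugeField (F.P p.K) k (SU N))
    (V' : GaugeField (F.P p.K) (k + 1) (SU N)) : 0 ≤ collarBAt F N ν M p g k δlo δhi s U V' :=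
  Finset.sum_nonneg fun c _ => sub_nonneg.2 (bFactorAt_mono F N ν M p g k h s c U V')

/-- the (3.3) collar count is at most the number of χ_{k+1}-cubes. [bookkeeping] -/
theorem collarBAt_le_card (δlo δhi : ℝ) (s : SeqOfRecord F ν M g p.K k) (U : GaugeField (F.P p.K) k (SU N)) (V' : GaugeField (F.P p.K) (k + 1) (SU N)) :
    collarBAt F N ν M p g k δlo δhi s U V' ≤ Fintype.card (Iχ F ν p g k) := by
  unfold collarBAt
  calc ∑ c : Iχ F ν p g k, (bFactorAt F N ν M p g k δhi s c U V' - bFactorAt F N ν M p g k δlo s c U V') ≤ ∑ _c : Iχ F ν p g k, (1 : ℝ) :=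
        Finset.sum_le_sum fun c _ => by
          have h1 := bFactorAt_le_one F N ν M p g k δhi s c U V'
          have h0 := bFactorAt_nonneg F N ν M p g k δlo s c U V'
          linarith
    _ = Fintype.card (Iχ F ν p g k) := by rw [Finset.sum_const, nsmul_eq_mul, mul_one, Finset.card_univ]

/-- `|collarB| ≤ #cubes` (each summand lies in `[−1, 1]`). [bookkeeping] -/
theorem abs_collarBAt_le_card (δlo δhi : ℝ) (s : SeqOfRecord F ν M g p.K k) (U : GaugeField (F.P p.K) k (SU N)) (V' : GaugeField (F.P p.K) (k + 1) (SU N)) :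
    |collarBAt F N ν M p g k δlo δhi s U V'| ≤ Fintype.card (Iχ F ν p g k) := by
  unfold collarBAt
  refine (Finset.abs_sum_le_sum_abs _ _).trans ?_
  calc ∑ c : Iχ F ν p g k, |bFactorAt F N ν M p g k δhi s c U V' - bFactorAt F N ν M p g k δlo s c U V'| ≤ ∑ _c : Iχ F ν p g k, (1 : ℝ) :=
        Finset.sum_le_sum fun c _ => by
          have h1 := bFactorAt_le_one F N ν M p g k δhi s c U V'
          have h0 := bFactorAt_nonneg F N ν M p g k δhi s c U V'
          have h1' := bFactorAt_le_one F N ν M p g k δlo s c U V'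
          have h0' := bFactorAt_nonneg F N ν M p g k δlo s c U V'
          rw [abs_le]; constructor <;> linarith
    _ = Fintype.card (Iχ F ν p g k) := by rw [Finset.sum_const, nsmul_eq_mul, mul_one, Finset.card_univ]

/-- the (3.3) collar count is jointly measurable in `(V′, U)` under (H-U). [bookkeeping] -/
theorem measurable_collarBAt (δlo δhi : ℝ) (s : SeqOfRecord F ν M g p.K k) :
    Measurable (fun z : GaugeField (F.P p.K) (k + 1) (SU N) × GaugeField (F.P p.K) k (SU N) => collarBAt F N ν M p g k δlo δhi s z.2 z.1) := by
  unfold collarBAt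
  exact Finset.measurable_sum _ fun c _ => (measurable_bFactorAt F N ν M p g k δhi s c).sub (measurable_bFactorAt F N ν M p g k δlo s c)

end CollarB

/-! ## §B7 The geometric grid of (3.3) letters below print's `2δ_k` -/

section BGrid

/-- **THE GEOMETRIC GRID OF (3.3) LETTERS** below print's `2δ_k` of record at the old level `k`: `δ′_j := 2δ_k · (1 − ρ′)^j` (`δ′_0 = 2δ_k`, `δ′_{j+1} = δ′_j(1 − ρ′)`) —
the (3.3) companion of the lane owner's `cutGrid` ([LF-I] p. 181: «we change the regularity conditions by a factor»). [bookkeeping] -/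
def bCutGrid (ν : Stage7Numerics) (A₁ : ℝ) (g : ℕ → ℝ) (k : ℕ) (ρ' : ℝ) (j : ℕ) : ℝ :=
  2 * deltaOfRecord ν g k A₁ * (1 - ρ') ^ j

/-- Face: the grid starts at print's letter `2δ_k`. [bookkeeping] -/
@[simp] theorem bCutGrid_zero (ν : Stage7Numerics) (A₁ : ℝ) (g : ℕ → ℝ) (k : ℕ) (ρ' : ℝ) : bCutGrid ν A₁ g k ρ' 0 = 2 * deltaOfRecord ν g k A₁ := by
  simp [bCutGrid]

/-- Face: depth `0` IS def-T's (3.3) letter of record at `(p, g, k)`. [bookkeeping] -/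
theorem bCutGrid_zero_eq_letter (ν : Stage7Numerics) (A₁ : ℝ) (p : B12.RunParams) (g : ℕ → ℝ) (k : ℕ) (ρ' : ℝ) :
    bCutGrid ν A₁ g k ρ' 0 = twoDeltaLetterOfRecord ν A₁ p g k := by
  simp [bCutGrid, twoDeltaLetterOfRecord]

/-- Face: one step down the grid multiplies by `1 − ρ′`. [bookkeeping] -/
theorem bCutGrid_succ (ν : Stage7Numerics) (A₁ : ℝ) (g : ℕ → ℝ) (k : ℕ) (ρ' : ℝ) (j : ℕ) :
    bCutGrid ν A₁ g k ρ' (j + 1) = bCutGrid ν A₁ g k ρ' j * (1 - ρ') := by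
  simp [bCutGrid, pow_succ, mul_assoc]

/-- one step down the grid does not go up in the meaningful regime `0 ≤ δ_k`, `0 ≤ ρ′ ≤ 1`. [bookkeeping] -/
theorem bCutGrid_succ_le_of_nonneg (ν : Stage7Numerics) (A₁ : ℝ) (g : ℕ → ℝ) (k : ℕ) (hδ : 0 ≤ deltaOfRecord ν g k A₁) {ρ' : ℝ} (hρ0 : 0 ≤ ρ')
    (hρ1 : ρ' ≤ 1) (j : ℕ) : bCutGrid ν A₁ g k ρ' (j + 1) ≤ bCutGrid ν A₁ g k ρ' j := by
  rw [bCutGrid_succ]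
  exact mul_le_of_le_one_right (mul_nonneg (by linarith) (pow_nonneg (by linarith) j)) (by linarith)

end BGrid


end Summit.QuantumFields.YangMills.Theorems.N21GappedTopPair13CoPH

end
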